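import Summits.CriticalPhenomena.PercolationContinuityZ3.Theorems.PercNearOneGluingNoHeavyLowerTailMajorityGluingHubRefreshBundles
import Summits.CriticalPhenomena.PercolationContinuityZ3.Theorems.PercTorusSliceFillingSliceFillingUpperBoundWindow
import HarnessLib

/-!
# «Three pairwise-separated cuts cost M²» (row M1-REM3) is FALSE — part I: the soft 4-star family, its events and the two inclusions
# (lane prim-rate, constants-miner 1, gen 9; CANDIDATES §GEN-9 R55, BENCH l.129 M1-REM3-NEG)

Support file for the closed crux `NoHeavyLowerTail` (stmt-CriticalPhenomena-4575), NEGATIVE side of the majority-gluing line; combinatorial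
half of the refutation of the inline hypothesis (REM3) of `HubOnly.Refresh.weakCell_of_agg_of_rem3` (the probabilities and the theorem
`HubOnly.SoftStar.not_rem3` are in part II, `…MajorityGluingHubRefreshRem3Refutation.lean`).

THE FAMILY.  `K_{k,4}`: vertex set `Fin (k+4)`; the four MARKED vertices `leaf 0 = a` (hub), `leaf 1, leaf 2, leaf 3 = v₁, v₂, v₃`, and `k` CENTRES
`ctr j`; every pair `{leaf i, ctr j}` has weight `1/3` (`wt`), every other pair weight `0`.  Events: `Z` (only leaf pairs open), `B j` (centre `j` has at
most one open leaf pair), `D X j` (centre `j` has no open pair to `X` together with one to its complement), `E3` (the (REM3) event: `v₁, v₂, v₃` cut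
from `a` with pairwise distinct clusters).  Inclusions: `good_subset_E3` (`Z ∩ ⋂_j B j ⊆ E3`: a walk leaving a leaf enters a centre and cannot leave it
through a second open pair; closure principle `SliceFilling.mem_of_reachable_of_closed`) and `cut_subset` (`{a ↮ v_i} ⊆ ⋃_{X ∈ sides i} ⋂_j D X j` with `X` := the marked vertices joined to `a`); the events `B j`,
`D X j` are determined by the (pairwise disjoint) stars `starAt j`, and `Z` by the complement of their union.  No sorries, no named facts.
[cite: Grimmett1999, §1.3 p. 10; §2.2]
-/
noncomputable section

namespace Summit.CriticalPhenomena.PercolationContinuityZ3.Theorems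

open MeasureTheory Set
open Literature.Probability.LatticeModels (prodBernoulli prodBernoulli_real_inter_of_determinedBy_disjoint
  prodBernoulli_real_inter_biInter_of_determinedBy prodBernoulli_real_forall_notMem prodBernoulli_real_setOf_mem)
open Literature.Probability.Percolation
open scoped Classical

namespace HubOnly
namespace SoftStar

open Refresh (clus mem_clus self_mem_clus)

/-! ### The family -/

/-- The marked vertices: `leaf 0 = a` (hub), `leaf i = v_i` (`i = 1,2,3`). [folklore] -/
def leaf (k : ℕ) (i : Fin 4) : Fin (k + 4) := ⟨i, by omega⟩

/-- The `j`-th centre. [folklore] -/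
def ctr (k : ℕ) (j : Fin k) : Fin (k + 4) := ⟨j + 4, by omega⟩

/-- The leaf pair `{leaf i, ctr j}`. [folklore] -/
def lp (k : ℕ) (i : Fin 4) (j : Fin k) : Sym2 (Fin (k + 4)) := s(leaf k i, ctr k j)

/-- The four leaf pairs at the centre `j`. [folklore] -/
def starAt (k : ℕ) (j : Fin k) : Finset (Sym2 (Fin (k + 4))) := Finset.univ.image fun i => lp k i j

/-- The weight `1/3`. [folklore] -/
def third : unitInterval := ⟨1 / 3, by norm_num, by norm_num⟩

/-- The weights of the soft 4-star family: `1/3` on the leaf pairs, `0` elsewhere. [folklore] -/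
def wt (k : ℕ) (e : Sym2 (Fin (k + 4))) : unitInterval := if ∃ i j, e = lp k i j then third else 0

variable {k : ℕ}

/-- Leaves are injective. [folklore] -/
theorem leaf_injective : Function.Injective (leaf k) := by
  intro i i' h; have := congrArg Fin.val h; simp [leaf] at this; exact Fin.ext this

/-- Centres are injective. [folklore] -/
theorem ctr_injective : Function.Injective (ctr k) := by
  intro j j' h; have := congrArg Fin.val h; simp [ctr] at this; exact Fin.ext this

/-- A leaf is not a centre. [folklore] -/
theorem leaf_ne_ctr (i : Fin 4) (j : Fin k) : leaf k i ≠ ctr k j := by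
  intro h; have := congrArg Fin.val h; simp [leaf, ctr] at this; omega

/-- Leaf pairs determine their leaf and their centre. [folklore] -/
theorem lp_eq_lp_iff {i i' : Fin 4} {j j' : Fin k} : lp k i j = lp k i' j' ↔ i = i' ∧ j = j' := by
  constructor
  · intro h
    rcases Sym2.eq_iff.1 h with ⟨h1, h2⟩ | ⟨h1, _⟩
    · exact ⟨leaf_injective h1, ctr_injective h2⟩
    · exact absurd h1 (leaf_ne_ctr i j')
  · rintro ⟨rfl, rfl⟩; rfl

/-- `s(leaf i, v)` is a leaf pair only if `v` is the centre and the leaf is `i`. [folklore] -/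
theorem eq_of_mk_leaf_eq_lp {i i' : Fin 4} {j : Fin k} {v : Fin (k + 4)} (h : s(leaf k i, v) = lp k i' j) :
    i = i' ∧ v = ctr k j := by
  rcases Sym2.eq_iff.1 h with ⟨h1, h2⟩ | ⟨h1, _⟩
  · exact ⟨leaf_injective h1, h2⟩
  · exact absurd h1 (leaf_ne_ctr i j)

/-- `s(ctr j, v)` is a leaf pair only if `v` is the leaf and the centre is `j`. [folklore] -/
theorem eq_of_mk_ctr_eq_lp {i : Fin 4} {j j' : Fin k} {v : Fin (k + 4)} (h : s(ctr k j, v) = lp k i j') :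
    j = j' ∧ v = leaf k i := by
  rcases Sym2.eq_iff.1 h with ⟨h1, _⟩ | ⟨h1, h2⟩
  · exact absurd h1.symm (leaf_ne_ctr i j)
  · exact ⟨ctr_injective h1, h2⟩

/-- Membership in `starAt`. [folklore] -/
theorem mem_starAt {j : Fin k} {e : Sym2 (Fin (k + 4))} : e ∈ starAt k j ↔ ∃ i, e = lp k i j := by
  simp [starAt, eq_comm]

/-- `starAt j` has four pairs. [folklore] -/
theorem card_starAt (j : Fin k) : (starAt k j).card = 4 := by
  rw [starAt, Finset.card_image_of_injective _ (fun i i' h => (lp_eq_lp_iff.1 h).1)]; simp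

/-- Distinct centres have disjoint stars. [folklore] -/
theorem pairwiseDisjoint_starAt : (↑(Finset.univ : Finset (Fin k)) : Set (Fin k)).PairwiseDisjoint (starAt k) := by
  intro j _ j' _ hjj'
  rw [Function.onFun, Finset.disjoint_left]
  intro e he he'
  obtain ⟨i, rfl⟩ := mem_starAt.1 he
  obtain ⟨i', h⟩ := mem_starAt.1 he'
  exact hjj' (lp_eq_lp_iff.1 h).2

/-- The weight of a leaf pair is `1/3`. [folklore] -/
theorem wt_lp (i : Fin 4) (j : Fin k) : (wt k (lp k i j) : ℝ) = 1 / 3 := by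
  have : ∃ i' j', lp k i j = lp k i' j' := ⟨i, j, rfl⟩
  simp [wt, this, third]

/-- The weight of a non-leaf pair is `0`. [folklore] -/
theorem wt_of_not_lp {e : Sym2 (Fin (k + 4))} (h : ¬ ∃ i j, e = lp k i j) : (wt k e : ℝ) = 0 := by
  simp [wt, h]

/-! ### The events -/

/-- `Z`: only leaf pairs are open (a probability-one event). [folklore] -/
def Z (k : ℕ) : Set (BondConfig (Fin (k + 4))) := {ω | ∀ e ∈ ω, ∃ i j, e = lp k i j}

/-- `B j`: the centre `j` has at most one open leaf pair. [folklore] -/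
def B (k : ℕ) (j : Fin k) : Set (BondConfig (Fin (k + 4))) := {ω | ∀ i i', lp k i j ∈ ω → lp k i' j ∈ ω → i = i'}

/-- `D X j`: the centre `j` has no open pair to `X` together with an open pair to the complement of `X`. [folklore] -/
def D (k : ℕ) (X : Finset (Fin 4)) (j : Fin k) : Set (BondConfig (Fin (k + 4))) :=
  {ω | ¬ ((∃ x ∈ X, lp k x j ∈ ω) ∧ ∃ y ∉ X, lp k y j ∈ ω)}

/-- The (REM3) event of the row for hub `a = leaf 0` and relays `leaf 1, leaf 2, leaf 3`: all three cut from `a`, clusters pairwise distinct. [folklore] -/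
def E3 (k : ℕ) : Set (BondConfig (Fin (k + 4))) :=
  {ω | ¬ (openGraph ω).Reachable (leaf k 0) (leaf k 1) ∧ ¬ (openGraph ω).Reachable (leaf k 0) (leaf k 2) ∧
    ¬ (openGraph ω).Reachable (leaf k 0) (leaf k 3) ∧ clus ω (leaf k 1) ≠ clus ω (leaf k 2) ∧
    clus ω (leaf k 1) ≠ clus ω (leaf k 3) ∧ clus ω (leaf k 2) ≠ clus ω (leaf k 3)}

/-! ### Inclusion 1: good configurations separate all four marked vertices -/

/-- On `Z ∩ ⋂ B j`, two distinct leaves are not joined by an open path. [folklore] -/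
theorem not_reachable_leaf {ω : BondConfig (Fin (k + 4))} (hZ : ω ∈ Z k) (hB : ∀ j, ω ∈ B k j) {x y : Fin 4} (hxy : x ≠ y) :
    ¬ (openGraph ω).Reachable (leaf k x) (leaf k y) := by
  -- the set `S` = {leaf x} ∪ {centres joined to leaf x by an open pair} is closed under adjacency
  set S : Set (Fin (k + 4)) := {v | v = leaf k x ∨ ∃ j, v = ctr k j ∧ lp k x j ∈ ω} with hS_def
  have hS : ∀ u v, u ∈ S → (openGraph ω).Adj u v → v ∈ S := by
    intro u v hu huv
    obtain ⟨huv', _⟩ := (openGraph_adj ω u v).1 huv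
    obtain ⟨i, j, hij⟩ := hZ _ huv'
    rcases hu with rfl | ⟨j₀, rfl, hj₀⟩
    · obtain ⟨rfl, rfl⟩ := eq_of_mk_leaf_eq_lp hij
      exact Or.inr ⟨j, rfl, hij ▸ huv'⟩
    · obtain ⟨rfl, rfl⟩ := eq_of_mk_ctr_eq_lp hij
      have hi : lp k i j₀ ∈ ω := by rw [lp, Sym2.eq_swap]; exact huv'
      have := hB j₀ x i hj₀ hi
      subst this
      exact Or.inl rfl
  intro h
  have hy : leaf k y ∈ S := SliceFilling.mem_of_reachable_of_closed hS h (Or.inl rfl)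
  rcases hy with hy | ⟨j, hy, -⟩
  · exact hxy (leaf_injective hy).symm
  · exact leaf_ne_ctr y j hy

/-- **Inclusion 1.** `Z ∩ ⋂_j B j ⊆ E₃`. [folklore] -/
theorem good_subset_E3 : Z k ∩ (⋂ j ∈ (Finset.univ : Finset (Fin k)), B k j) ⊆ E3 k := by
  rintro ω ⟨hZ, hB⟩
  have hB' : ∀ j, ω ∈ B k j := fun j => (Set.mem_iInter₂.1 hB) j (Finset.mem_univ j)
  have hsep : ∀ x y : Fin 4, x ≠ y → ¬ (openGraph ω).Reachable (leaf k x) (leaf k y) :=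
    fun x y hxy => not_reachable_leaf hZ hB' hxy
  have hcl : ∀ x y : Fin 4, x ≠ y → clus ω (leaf k x) ≠ clus ω (leaf k y) := by
    intro x y hxy h
    have : leaf k y ∈ clus ω (leaf k x) := h ▸ self_mem_clus ω (leaf k y)
    exact hsep x y hxy (mem_clus.1 this)
  exact ⟨hsep 0 1 (by decide), hsep 0 2 (by decide), hsep 0 3 (by decide), hcl 1 2 (by decide), hcl 1 3 (by decide),
    hcl 2 3 (by decide)⟩

/-! ### Inclusion 2: a cut forces a consistent bipartition at every centre -/

/-- The candidate bipartition sides: subsets of the marked vertices containing `a = leaf 0` and not `v_i`. [folklore] -/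
def sides (i : Fin 4) : Finset (Finset (Fin 4)) := Finset.univ.filter fun X => (0 : Fin 4) ∈ X ∧ i ∉ X

/-- There are four candidate sides (for `i ≠ 0`). [folklore] -/
theorem card_sides {i : Fin 4} (hi : i ≠ 0) : (sides i).card = 4 := by
  revert hi; revert i; decide

/-- **Inclusion 2.** `{a ↮ v_i} ⊆ ⋃_{X ∈ sides i} ⋂_j D X j`. [folklore] -/
theorem cut_subset (i : Fin 4) :
    {ω : BondConfig (Fin (k + 4)) | ¬ (openGraph ω).Reachable (leaf k 0) (leaf k i)} ⊆
      ⋃ X ∈ sides i, ⋂ j ∈ (Finset.univ : Finset (Fin k)), D k X j := by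
  intro ω hω
  simp only [Set.mem_setOf_eq] at hω
  set X : Finset (Fin 4) := Finset.univ.filter fun x => (openGraph ω).Reachable (leaf k 0) (leaf k x) with hX
  have hXmem : ∀ x, x ∈ X ↔ (openGraph ω).Reachable (leaf k 0) (leaf k x) := fun x => by simp [hX]
  refine Set.mem_iUnion₂.2 ⟨X, ?_, Set.mem_iInter₂.2 fun j _ => ?_⟩
  · simp only [sides, Finset.mem_filter, Finset.mem_univ, true_and]
    exact ⟨(hXmem 0).2 (SimpleGraph.Reachable.refl _), fun h => hω ((hXmem i).1 h)⟩
  · rintro ⟨⟨x, hx, hxω⟩, y, hy, hyω⟩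
    apply hy
    rw [hXmem] at hx ⊢
    have h1 : (openGraph ω).Adj (leaf k x) (ctr k j) := (openGraph_adj ω _ _).2 ⟨hxω, leaf_ne_ctr x j⟩
    have h2 : (openGraph ω).Adj (ctr k j) (leaf k y) :=
      (openGraph_adj ω _ _).2 ⟨by rw [Sym2.eq_swap]; exact hyω, (leaf_ne_ctr y j).symm⟩
    exact hx.trans (h1.reachable.trans h2.reachable)

/-! ### Measurability and locality of the events -/

/-- All events are measurable (finite configuration space). [folklore] -/
theorem mset (S : Set (BondConfig (Fin (k + 4)))) : MeasurableSet S := MeasurableSet.of_discrete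

/-- `B j` is determined by the pairs at the centre `j`. [folklore] -/
theorem determinedBy_B (j : Fin k) : DeterminedBy (B k j) (↑(starAt k j) : Set (Sym2 (Fin (k + 4)))) := by
  rw [determinedBy_iff]
  intro ω ω' h
  have key : ∀ i, lp k i j ∈ ω ↔ lp k i j ∈ ω' := fun i => by
    have he : lp k i j ∈ (↑(starAt k j) : Set (Sym2 (Fin (k + 4)))) := Finset.mem_coe.2 (mem_starAt.2 ⟨i, rfl⟩)
    have := Set.ext_iff.1 h (lp k i j)
    simpa [he] using this
  simp only [B, Set.mem_setOf_eq, key]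

/-- `D X j` is determined by the pairs at the centre `j`. [folklore] -/
theorem determinedBy_D (X : Finset (Fin 4)) (j : Fin k) :
    DeterminedBy (D k X j) (↑(starAt k j) : Set (Sym2 (Fin (k + 4)))) := by
  rw [determinedBy_iff]
  intro ω ω' h
  have key : ∀ i, lp k i j ∈ ω ↔ lp k i j ∈ ω' := fun i => by
    have he : lp k i j ∈ (↑(starAt k j) : Set (Sym2 (Fin (k + 4)))) := Finset.mem_coe.2 (mem_starAt.2 ⟨i, rfl⟩)
    have := Set.ext_iff.1 h (lp k i j)
    simpa [he] using this
  simp only [D, Set.mem_setOf_eq, key]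

/-- `Z` is determined by the complement of the union of the stars. [folklore] -/
theorem determinedBy_Z :
    DeterminedBy (Z k) (⋃ j ∈ (Finset.univ : Finset (Fin k)), (↑(starAt k j) : Set (Sym2 (Fin (k + 4)))))ᶜ := by
  rw [determinedBy_iff]
  have aux : ∀ ω ω' : BondConfig (Fin (k + 4)),
      ω ∩ (⋃ j ∈ (Finset.univ : Finset (Fin k)), (↑(starAt k j) : Set (Sym2 (Fin (k + 4)))))ᶜ =
        ω' ∩ (⋃ j ∈ (Finset.univ : Finset (Fin k)), (↑(starAt k j) : Set (Sym2 (Fin (k + 4)))))ᶜ →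
      ω' ∈ Z k → ω ∈ Z k := by
    intro ω ω' h hω' e he
    by_contra hne
    have hec : e ∈ (⋃ j ∈ (Finset.univ : Finset (Fin k)), (↑(starAt k j) : Set (Sym2 (Fin (k + 4)))))ᶜ := by
      intro hmem
      obtain ⟨j, -, hj⟩ := Set.mem_iUnion₂.1 hmem
      obtain ⟨i, rfl⟩ := mem_starAt.1 (Finset.mem_coe.1 hj)
      exact hne ⟨i, j, rfl⟩
    have : e ∈ ω' := by
      have h1 : e ∈ ω ∩ _ := ⟨he, hec⟩
      rw [h] at h1
      exact h1.1
    exact hne (hω' e this)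
  intro ω ω' h
  exact ⟨fun hω => aux ω' ω h.symm hω, fun hω' => aux ω ω' h hω'⟩

end SoftStar
end HubOnly
end Summit.CriticalPhenomena.PercolationContinuityZ3.Theorems
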